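import Literature.Analysis.FluidPDE.TypeIAncientMildClassical
import Summits.NavierStokesRegularity.NavierStokesRegularity.Theorems.SymmetryModuliCountAxisymEndLiouvilleStubSwirlComparisonTools
import Summits.NavierStokesRegularity.NavierStokesRegularity.Theorems.SymmetryModuliCountAxisymEndLiouvilleStubSwirlEquation
import Summits.NavierStokesRegularity.NavierStokesRegularity.Theorems.SymmetryModuliCountAxisymEndLiouvilleStubWeakMaxLocal

/-!
# Weighted maximum principle for the swirl of axisymmetric Type-I ancient mild fields

Stub `stub_swirlComparison` of the line `absorbing-axis-swirl-extinction` for the crux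
`AxisymEndLiouville` (stmt-NavierStokesRegularity-14061, route SymmetryModuliCount).

For `u ∈ 𝒜_C` (`IsTypeIAncientMild C u`) axisymmetric on `t < 0` and a weight profile `W`
(`C²` on `(0,∞)`, continuous on `[0,∞)`, `W ≥ 0`, `W' ≥ 0`, `ρ ≤ K W(ρ)`,
`W'' − (ρ/2 + 1/ρ − C) W' + λ W ≤ 0`), the swirl obeys
`|Γ(t,x)| ≤ C K (t/t')^λ W(r/√(−t))` for all `t' < t < 0`.

Proof: one-sided comparison of `σΓ` (`σ = ±1`) with the supersolution
`Ψ(s,y) = C K (s/t')^λ W(r(y)/√(−s))` of the swirl operator `∂ₛ + u·∇ + (2/r)∂ᵣ − Δ`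
(KNSS 2009 (1.8), tree `swirl_transport_holds` via `stub_swirlEquation`) on `[t', t] × B̄(0,R)`
(`stub_weakMaxPrincipleLocal`, sub-solution step `subsolution_step`), with the escape barrier
`ε e^{β(s−t')}(1+|y|²)` of the tree's `SwirlMaximumPrinciple`; then `R → ∞`, `ε → 0`.
The Type-I bound enters as `|√(−s) u_r| ≤ C` and `|Γ(t',·)| ≤ C r/√(−t')`; "ancient" is spent
by the caller as `t' → −∞`.
-/

noncomputable section

-- the summit and its single problem share the name (D-0017 nested layout)
set_option linter.dupNamespace false

open Set Function Filter Topology MeasureTheory InnerProductSpace Metric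
open scoped RealInnerProductSpace Laplacian ContDiff NNReal

namespace Summit.NavierStokesRegularity.NavierStokesRegularity.Theorems.AxisymEndLiouville.AbsorbingAxisSwirlExtinction

open Literature.Analysis.FluidPDE

/-- `ℝ³`. -/
local notation "E3" => EuclideanSpace ℝ (Fin 3)

/-! ### The comparison on `[t', t] × B̄(0, R)` -/

/-- **One-sided comparison on a ball.**  For `u ∈ 𝒜_C` axisymmetric on `t < 0`, a weight
profile `W` as in `stub_swirlComparison`, a sign `σ = ±1`, `ε > 0` and
`R ≥ (C/√(−t))/ε`: on `[t', t] × B̄(0, R)`,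
`σΓ(s,y) ≤ C K (s/t')^λ W(r/√(−s)) + ε e^{β(s−t')} (1 + |y|²)`, `β = 7 + C/√(−t)`
(weak maximum principle `stub_weakMaxPrincipleLocal` for `w = σΓ − Ψ − ψ` on
`K = B̄(0,R)`, `U = B(0,R) ∖ axis`: sub-solution step `subsolution_step`; `w ≤ 0` at `s = t'` by
`|Γ| ≤ r|u| ≤ Cρ ≤ C K W(ρ)`, on the axis since `Γ = 0`, on the sphere since
`|Γ| ≤ R V ≤ ε(1+R²)`). -/
theorem comparison_on_ball (C lam K : ℝ) (W : ℝ → ℝ) (hlam : 0 < lam) (hK : 0 < K)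
    (hWc : ContinuousOn W (Ici 0)) (hW2 : ContDiffOn ℝ 2 W (Ioi 0))
    (hW0 : ∀ ρ, 0 ≤ ρ → 0 ≤ W ρ) (hWK : ∀ ρ, 0 < ρ → ρ ≤ K * W ρ)
    (hW1 : ∀ ρ, 0 < ρ → 0 ≤ deriv W ρ)
    (hWineq : ∀ ρ, 0 < ρ → deriv (deriv W) ρ - (ρ / 2 + 1 / ρ - C) * deriv W ρ + lam * W ρ ≤ 0)
    (u : ℝ → E3 → E3) (hu : IsTypeIAncientMild C u) (haxi : ∀ t < 0, IsAxisymmetric (u t))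
    {t' t : ℝ} (ht' : t' < t) (ht : t < 0) {σ : ℝ} (hσ : σ = 1 ∨ σ = -1) {ε R : ℝ}
    (hε : 0 < ε) (hR : C / Real.sqrt (-t) / ε ≤ R) :
    ∀ s ∈ Icc t' t, ∀ y ∈ closedBall (0 : E3) R,
      σ * swirl (u s) y - C * K * (s / t') ^ lam * W (cylRadius y / Real.sqrt (-s)) -
        ε * Real.exp ((6 + C / Real.sqrt (-t) + 1) * (s - t')) * (1 + ‖y‖ ^ 2) ≤ 0 := by
  have hC : 0 ≤ C := hu.nonneg
  have ht'0 : t' < 0 := ht'.trans ht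
  -- the classical window `S = (t' - 1, 0)` and the swirl equation on it
  obtain ⟨p, hcl, hpde⟩ := stub_swirlEquation C u hu haxi (t' - 1) (by linarith)
  -- constants (made opaque)
  set M : ℝ := C * K with hM
  have hM0 : 0 ≤ M := by rw [hM]; exact mul_nonneg hC hK.le
  set V : ℝ := C / Real.sqrt (-t) with hV
  have hV0 : 0 ≤ V := by rw [hV]; exact div_nonneg hC (Real.sqrt_nonneg _)
  set β : ℝ := 6 + V + 1 with hβ
  have hβ0 : 0 ≤ β := by rw [hβ]; positivity
  clear_value M V β
  have hσabs : ∀ a : ℝ, σ * a ≤ |a| := fun a => by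
    rcases hσ with h | h
    · rw [h, one_mul]; exact le_abs_self a
    · rw [h, neg_one_mul]; exact neg_le_abs a
  have hR0 : 0 ≤ R := le_trans (div_nonneg hV0 hε.le) hR
  set S : Set ℝ := Ioo (t' - 1) 0 with hS
  have hSo : IsOpen S := isOpen_Ioo
  have hIccS : ∀ s ∈ Icc t' t, s ∈ S := fun s hs => ⟨by linarith [hs.1], lt_of_le_of_lt hs.2 ht⟩
  -- the comparison function, the barrier, and their time derivatives
  set Ψ : ℝ → E3 → ℝ := fun s y => M * (s / t') ^ lam * W (cylRadius y / Real.sqrt (-s)) with hΨ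
  set ψ : ℝ → E3 → ℝ := fun s y => ε * Real.exp (β * (s - t')) * (1 + ‖y‖ ^ 2) with hψ
  set w : ℝ → E3 → ℝ := fun s y => σ * swirl (u s) y - Ψ s y - ψ s y with hw
  set Γₜ : ℝ → E3 → ℝ := fun s y => timeDerivWithin S (fun s' => swirl (u s')) s y with hΓₜ
  set Ψₜ : ℝ → E3 → ℝ := fun s y =>
    M * (lam * (s / t') ^ lam / s * W (cylRadius y / Real.sqrt (-s)) +
      (s / t') ^ lam * (deriv W (cylRadius y / Real.sqrt (-s)) *
        (cylRadius y / Real.sqrt (-s) / (2 * (-s))))) with hΨₜ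
  set wₜ : ℝ → E3 → ℝ := fun s y => σ * Γₜ s y - Ψₜ s y - β * ψ s y with hwₜ
  set K' : Set E3 := closedBall 0 R with hK'
  set U : Set E3 := ball 0 R ∩ {y | cylRadius y ≠ 0} with hU
  have hKc : IsCompact K' := isCompact_closedBall _ _
  have hUo : IsOpen U := isOpen_ball.inter (isOpen_ne_fun continuous_cylRadius continuous_const)
  have hUK : U ⊆ K' := fun y hy => ball_subset_closedBall hy.1
  -- regularity of the velocity on the window
  have hsm := hcl.smooth_velocity
  have hvC2 : ∀ s ∈ S, ContDiff ℝ 2 (u s) := fun s hs =>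
    (hcl.contDiff_velocity hs).of_le (by norm_cast)
  -- times in the window
  have hneg : ∀ s ∈ Icc t' t, 0 < -s := fun s hs => by linarith [hs.2]
  have hsqrt : ∀ s ∈ Icc t' t, 0 < Real.sqrt (-s) := fun s hs => Real.sqrt_pos.2 (hneg s hs)
  have hratio : ∀ s ∈ Icc t' t, 0 < s / t' := fun s hs =>
    div_pos_of_neg_of_neg (by linarith [hs.2]) ht'0
  -- velocity bound on the window
  have huV : ∀ s ∈ Icc t' t, ∀ y, ‖u s y‖ ≤ V := by
    intro s hs y
    refine (hu.norm_le (by linarith [hs.2]) y).trans ?_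
    rw [hV]
    exact div_le_div_of_nonneg_left hC (Real.sqrt_pos.2 (by linarith))
      (Real.sqrt_le_sqrt (by linarith [hs.2]))
  -- `Ψ ≥ 0`
  have hΨ0 : ∀ s ∈ Icc t' t, ∀ y, 0 ≤ Ψ s y := by
    intro s hs y
    simp only [hΨ]
    exact mul_nonneg (mul_nonneg hM0 (Real.rpow_nonneg (hratio s hs).le _))
      (hW0 _ (div_nonneg (cylRadius_nonneg y) (Real.sqrt_nonneg _)))
  -- `ψ ≥ ε (1 + |y|²)`
  have hψ1 : ∀ s ∈ Icc t' t, ∀ y, ε * (1 + ‖y‖ ^ 2) ≤ ψ s y := by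
    intro s hs y
    simp only [hψ]
    have hexp1 : 1 ≤ Real.exp (β * (s - t')) := Real.one_le_exp (mul_nonneg hβ0 (by linarith [hs.1]))
    have : ε * (1 + ‖y‖ ^ 2) * 1 ≤ ε * (1 + ‖y‖ ^ 2) * Real.exp (β * (s - t')) :=
      mul_le_mul_of_nonneg_left hexp1 (by positivity)
    linarith
  -- the cylindrical radius is at most the norm
  have hcyl : ∀ y : E3, cylRadius y ≤ ‖y‖ := fun y => by
    rw [cylRadius, EuclideanSpace.norm_eq, Fin.sum_univ_three]
    refine Real.sqrt_le_sqrt ?_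
    simp only [Real.norm_eq_abs, sq_abs]
    nlinarith [sq_nonneg (y 2)]
  -- `σ Γ ≤ r ‖u‖`
  have hσΓ : ∀ s y, σ * swirl (u s) y ≤ cylRadius y * ‖u s y‖ := fun s y =>
    (hσabs _).trans (abs_swirl_le_cylRadius_mul_norm (u s) y)
  -- (a) joint continuity
  have hc : ContinuousOn (uncurry w) (Icc t' t ×ˢ K') := by
    have hvc : ContinuousOn (uncurry u) (Icc t' t ×ˢ K') :=
      hsm.continuousOn.mono (prod_mono (fun s hs => hIccS s hs) (subset_univ _))
    have h1 : ContinuousOn (fun q : ℝ × E3 => ⟪rotGenL q.2, uncurry u q⟫) (Icc t' t ×ˢ K') :=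
      (rotGenL.continuous.comp continuous_snd).continuousOn.inner hvc
    have harg : ContinuousOn (fun q : ℝ × E3 => cylRadius q.2 / Real.sqrt (-q.1)) (Icc t' t ×ˢ K') := by
      refine ((continuous_cylRadius.comp continuous_snd).continuousOn).div
        ((Real.continuous_sqrt.comp (continuous_neg.comp continuous_fst)).continuousOn) ?_
      rintro ⟨s, y⟩ ⟨hs, -⟩
      exact (hsqrt s hs).ne'
    have hWq : ContinuousOn (fun q : ℝ × E3 => W (cylRadius q.2 / Real.sqrt (-q.1))) (Icc t' t ×ˢ K') :=
      hWc.comp harg fun q _ => div_nonneg (cylRadius_nonneg _) (Real.sqrt_nonneg _)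
    have hpow : Continuous fun q : ℝ × E3 => (q.1 / t') ^ lam :=
      (continuous_fst.div_const t').rpow_const fun _ => Or.inr hlam.le
    have h2 : ContinuousOn (fun q : ℝ × E3 => M * (q.1 / t') ^ lam *
        W (cylRadius q.2 / Real.sqrt (-q.1))) (Icc t' t ×ˢ K') :=
      ((continuousOn_const.mul hpow.continuousOn).mul hWq)
    have h3 : Continuous fun q : ℝ × E3 => ε * Real.exp (β * (q.1 - t')) * (1 + ‖q.2‖ ^ 2) := by
      fun_prop
    refine ((((continuousOn_const (c := σ)).mul h1).sub h2).sub h3.continuousOn).congr fun q _ => ?_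
    simp only [hw, hΨ, hψ, uncurry, rotGenL_apply, swirl_eq_inner_rotGen, Pi.sub_apply, Pi.mul_apply]
  -- (b) `C²` slices on `U`
  have h2 : ∀ s ∈ Ioc t' t, ContDiffOn ℝ 2 (w s) U := by
    intro s hs
    have hsI : s ∈ Icc t' t := ⟨hs.1.le, hs.2⟩
    have hsS : s ∈ S := hIccS s hsI
    have hA : ContDiff ℝ 2 fun y => σ * swirl (u s) y := contDiff_const.mul (contDiff_swirl (hvC2 s hsS))
    have hB : ContDiffOn ℝ 2 (Ψ s) U := by
      intro y hy
      have hP := (stub_cylProfileCalculus W hW2 (Real.sqrt (-s)) (hsqrt s hsI) y hy.2).1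
      have : ContDiffAt ℝ 2 (fun y => M * (s / t') ^ lam * W (cylRadius y / Real.sqrt (-s))) y :=
        contDiffAt_const.mul hP
      exact this.contDiffWithinAt
    have hCψ : ContDiff ℝ 2 (ψ s) :=
      contDiff_const.mul (contDiff_const.add (contDiff_norm_sq ℝ))
    have e : w s = (fun y => σ * swirl (u s) y) - Ψ s - ψ s := by
      funext y; simp only [hw, Pi.sub_apply]
    rw [e]
    exact (hA.contDiffOn.sub hB).sub hCψ.contDiffOn
  -- (c) the left time derivative
  have ht_ : ∀ s ∈ Ioc t' t, ∀ y ∈ U, HasDerivWithinAt (fun s' => w s' y) (wₜ s y) (Icc t' s) s := by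
    intro s hs y hy
    have hsI : s ∈ Icc t' t := ⟨hs.1.le, hs.2⟩
    have hsS : s ∈ S := hIccS s hsI
    have hs0 : s < 0 := by linarith [hs.2]
    -- swirl
    have hud : DifferentiableAt ℝ (fun s' => u s' y) s :=
      (hsm.differentiableWithinAt_time hsS y).differentiableAt (hSo.mem_nhds hsS)
    have hΓd : DifferentiableAt ℝ (fun s' => swirl (u s') y) s := by
      simp only [swirl_eq_inner_rotGen]
      exact (differentiableAt_const _).inner ℝ hud
    have hΓ : HasDerivAt (fun s' => swirl (u s') y) (Γₜ s y) s := by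
      have h := hΓd.hasDerivAt
      have e : Γₜ s y = deriv (fun s' => swirl (u s') y) s := by
        simp only [hΓₜ, timeDerivWithin_apply, derivWithin_of_isOpen hSo hsS]
      rw [e]; exact h
    -- the comparison function
    have hρ : 0 < cylRadius y / Real.sqrt (-s) :=
      div_pos (lt_of_le_of_ne (cylRadius_nonneg y) (Ne.symm hy.2)) (hsqrt s hsI)
    have hΨd : HasDerivAt (fun s' => Ψ s' y) (Ψₜ s y) s := by
      have h := hasDerivAt_comparison_time M lam (cylRadius y) ht'0 hs0
        (hasDerivAt_deriv_of_contDiffOn hW2 hρ)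
      simp only [hΨ, hΨₜ]
      exact h
    -- the barrier
    have hψd : HasDerivAt (fun s' => ψ s' y) (β * ψ s y) s := by
      have h1 : HasDerivAt (fun s' => Real.exp (β * (s' - t'))) (Real.exp (β * (s - t')) * β) s := by
        have := (((hasDerivAt_id s).sub_const t').const_mul β).exp
        simpa using this
      have h2 := (h1.const_mul ε).mul_const (1 + ‖y‖ ^ 2)
      simp only [hψ]
      refine h2.congr_deriv ?_
      ring
    have h := ((hΓ.const_mul σ).sub hΨd).sub hψd
    simp only [hw, hwₜ]
    exact h.hasDerivWithinAt
  -- (d) the sub-solution implication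
  have hsub : ∀ s ∈ Ioc t' t, ∀ y ∈ U, fderiv ℝ (w s) y = 0 → (Δ (w s)) y ≤ 0 → wₜ s y ≤ 0 := by
    intro s hs y hy hgrad hlap
    have hsI : s ∈ Icc t' t := ⟨hs.1.le, hs.2⟩
    have hsS : s ∈ S := hIccS s hsI
    have hs0 : s < 0 := by linarith [hs.2]
    have hpde' := hpde s hsS y hy.2
    rw [convect_apply, partialDeriv_apply] at hpde'
    have hws : w s = fun z => σ * swirl (u s) z -
        M * (s / t') ^ lam * W (cylRadius z / Real.sqrt (-s)) -
        ε * Real.exp (β * (s - t')) * (1 + ‖z‖ ^ 2) := by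
      funext z; simp only [hw, hΨ, hψ]
    rw [hws] at hgrad hlap
    have key := subsolution_step (G := Γₜ s y) hW2 hW1 hWineq hM0 (Real.rpow_nonneg (hratio s hsI).le _)
      (by positivity : 0 < ε * Real.exp (β * (s - t'))) hV0 hβ.ge hs0 (hvC2 s hsS)
      (hu.norm_le hs0 y) (huV s hsI y) hy.2 hpde' hgrad hlap
    simp only [hwₜ, hΨₜ, hψ]
    exact key
  -- (e) the bottom `s = t'`
  have hbot : ∀ y ∈ K', w t' y ≤ 0 := by
    intro y _
    have ht'I : t' ∈ Icc t' t := ⟨le_rfl, ht'.le⟩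
    have hone : (t' / t') ^ lam = 1 := by rw [div_self ht'0.ne, Real.one_rpow]
    simp only [hw]
    have hψ0 : 0 ≤ ψ t' y := le_trans (by positivity) (hψ1 t' ht'I y)
    by_cases hax : cylRadius y = 0
    · rw [swirl_eq_zero_of_cylRadius_eq_zero (u t') hax, mul_zero]
      have := hΨ0 t' ht'I y
      linarith
    · have hρ : 0 < cylRadius y / Real.sqrt (-t') :=
        div_pos (lt_of_le_of_ne (cylRadius_nonneg y) (Ne.symm hax)) (hsqrt t' ht'I)
      have h1 : σ * swirl (u t') y ≤ C * (cylRadius y / Real.sqrt (-t')) := by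
        refine (hσΓ t' y).trans ?_
        rw [mul_div_assoc']
        rw [le_div_iff₀ (hsqrt t' ht'I)]
        calc cylRadius y * ‖u t' y‖ * Real.sqrt (-t')
            = cylRadius y * (‖u t' y‖ * Real.sqrt (-t')) := by ring
          _ ≤ cylRadius y * C := by
              refine mul_le_mul_of_nonneg_left ?_ (cylRadius_nonneg y)
              have := hu.norm_le ht'0 y
              rwa [le_div_iff₀ (hsqrt t' ht'I)] at this
          _ = C * cylRadius y := mul_comm _ _
      have h2 : C * (cylRadius y / Real.sqrt (-t')) ≤ Ψ t' y := by
        simp only [hΨ, hone, mul_one]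
        rw [hM, mul_assoc]
        exact mul_le_mul_of_nonneg_left (hWK _ hρ) hC
      linarith
  -- (f) the parabolic boundary: the axis and the sphere `|y| = R`
  have hlat : ∀ s ∈ Icc t' t, ∀ y ∈ K' \ U, w s y ≤ 0 := by
    intro s hs y hy
    have hyK : ‖y‖ ≤ R := mem_closedBall_zero_iff.1 hy.1
    have hΨ0' := hΨ0 s hs y
    have hψ1' := hψ1 s hs y
    simp only [hw]
    by_cases hax : cylRadius y = 0
    · rw [swirl_eq_zero_of_cylRadius_eq_zero (u s) hax, mul_zero]
      have : 0 ≤ ε * (1 + ‖y‖ ^ 2) := by positivity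
      linarith
    · have hyR : ‖y‖ = R := by
        have hnot : y ∉ ball (0 : E3) R := fun hb => hy.2 ⟨hb, hax⟩
        have : R ≤ ‖y‖ := by simpa using hnot
        exact le_antisymm hyK this
      have h1 : σ * swirl (u s) y ≤ R * V := by
        refine (hσΓ s y).trans ?_
        rw [← hyR]
        exact mul_le_mul (hcyl y) (huV s hs y) (norm_nonneg _) (norm_nonneg _)
      have h2 : R * V ≤ ε * (1 + ‖y‖ ^ 2) := by
        rw [hyR]
        have : V ≤ ε * R := by rwa [div_le_iff₀ hε, mul_comm] at hR
        nlinarith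
      linarith
  have hmax := stub_weakMaxPrincipleLocal K' U hKc hUo hUK t' t w wₜ hc h2 ht_ hsub hbot hlat
  intro s hs y hy
  have := hmax s hs y hy
  simpa only [hw, hΨ, hψ] using this

/-! ### The stub -/

/-- **STUB 3 (weighted maximum principle for the swirl).**  For `u ∈ 𝒜_C` axisymmetric on
`t < 0` and a weight profile `W` (continuous on `[0,∞)`, `C²` on `(0,∞)`, `W ≥ 0`, `W' ≥ 0`,
`ρ ≤ K W(ρ)`, `W'' − (ρ/2 + 1/ρ − C) W' + λ W ≤ 0`), the swirl satisfies
`|Γ(t, x)| ≤ C K (t/t')^λ W(r/√(−t))` for all `t' < t < 0` (`comparison_on_ball` for both signs,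
then `R → ∞`, `ε → 0`). -/
theorem stub_swirlComparison (C lam K : ℝ) (W : ℝ → ℝ) (hlam : 0 < lam) (hK : 0 < K)
    (hWc : ContinuousOn W (Ici 0)) (hW2 : ContDiffOn ℝ 2 W (Ioi 0))
    (hW0 : ∀ ρ, 0 ≤ ρ → 0 ≤ W ρ) (hWK : ∀ ρ, 0 < ρ → ρ ≤ K * W ρ)
    (hW1 : ∀ ρ, 0 < ρ → 0 ≤ deriv W ρ)
    (hWineq : ∀ ρ, 0 < ρ → deriv (deriv W) ρ - (ρ / 2 + 1 / ρ - C) * deriv W ρ + lam * W ρ ≤ 0)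
    (u : ℝ → E3 → E3) (hu : IsTypeIAncientMild C u) (haxi : ∀ t < 0, IsAxisymmetric (u t))
    (t' t : ℝ) (ht' : t' < t) (ht : t < 0) (x : E3) :
    |swirl (u t) x| ≤ C * K * (t / t') ^ lam * W (cylRadius x / Real.sqrt (-t)) := by
  -- both signs
  suffices key : ∀ σ : ℝ, (σ = 1 ∨ σ = -1) →
      σ * swirl (u t) x ≤ C * K * (t / t') ^ lam * W (cylRadius x / Real.sqrt (-t)) by
    have h1 := key 1 (Or.inl rfl)
    have h2 := key (-1) (Or.inr rfl)
    rw [one_mul] at h1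
    rw [neg_one_mul] at h2
    exact abs_le.2 ⟨by linarith, h1⟩
  intro σ hσ
  set V : ℝ := C / Real.sqrt (-t) with hV
  set β : ℝ := 6 + V + 1 with hβ
  -- `ε → 0` in the comparison on large balls
  refine le_of_forall_pos_le_add fun η hη => ?_
  set A : ℝ := Real.exp (β * (t - t')) * (1 + ‖x‖ ^ 2) with hA
  have hApos : 0 < A := by positivity
  have h := comparison_on_ball C lam K W hlam hK hWc hW2 hW0 hWK hW1 hWineq u hu haxi ht' ht hσ
    (ε := η / A) (R := max (V / (η / A)) ‖x‖) (div_pos hη hApos) (le_max_left _ _) t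
    ⟨ht'.le, le_rfl⟩ x (mem_closedBall_zero_iff.2 (le_max_right _ _))
  have e : η / A * Real.exp (β * (t - t')) * (1 + ‖x‖ ^ 2) = η := by
    rw [hA]; field_simp
  rw [e] at h
  linarith

end Summit.NavierStokesRegularity.NavierStokesRegularity.Theorems.AxisymEndLiouville.AbsorbingAxisSwirlExtinction

end
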